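import Literature.Analysis.Fourier.GradientBoundSchwartz
import Literature.Analysis.Fourier.SobolevMultiplierBoundProofs
import HarnessLib

/-!
# Annular Fourier cut-offs and the symbols of Rauch's step (6)

Fourier-side bookkeeping for the discharge of
`Literature.Analysis.Fourier.isLpMultiplier_of_gradientLpBound` ([Rauch1986, Proof of Theorem
p. 483, (6)]: "Let `ψ = |D|χ` ... `‖D_l M^{αβ}(D)|D|⁻¹ψ‖_{Lᵖ} ≤ c Σⱼ ‖Dⱼ|D|⁻¹ψ‖_{Lᵖ}`").
Instead of the dense class `|D|C₀^∞` we use annular Fourier cut-offs: with a fixed bump `β`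
(`= 1` on the unit ball, supported in the ball of radius `2`) put
`ρ_n(ξ) = β(ξ/(n+1)) - β((n+1)ξ)` (`annulusCutoff`), which is smooth, compactly supported,
vanishes for `|ξ| ≤ 1/(n+1)`, is bounded by `1` and tends to `1` at every `ξ ≠ 0`. For a real
`m` smooth away from the origin, `ρ_n m` is a `C_c^∞`, hence Schwartz, symbol
(`annulusSymbol`); in particular the three symbols of the argument,
`ρ_n` (`rhoSymbol`), `a_{n,j}(ξ) = ρ_n(ξ) ξⱼ/(2πi|ξ|²)` (`aSymbol`, the symbol of
`∂ⱼ(-Δ)⁻¹ρ_n(D)`) and `b_{n,j}(ξ) = ρ_n(ξ) (-iξⱼ/|ξ|)` (`bSymbol` = `ρ_n rⱼ`, a cut-off Riesz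
symbol), and the two pointwise identities behind "`Σⱼ ∂ⱼφ_{n,j} = ψ_n`" and
"`∂_lφ_{n,j} = -R_l θ_{n,j}`": `Σⱼ 2πiξⱼ a_{n,j} = ρ_n` (`sum_deriv_mul_aSymbol`) and
`2πiξ_l a_{n,j} = -r_l b_{n,j}` (`deriv_mul_aSymbol_eq`). Also: the Fourier transform of a
Schwartz Fourier-multiplier image (`coe_fourierMultiplierCLM_schwartz`,
`fourier_coe_fourierMultiplierCLM_schwartz`), of a partial derivative
(`fourier_partialDeriv_schwartz`), and the dilation-invariant `L¹` bound
`‖𝓕⁻¹ρ_n‖_{L¹} ≤ 2‖𝓕⁻¹β‖_{L¹}` (`lintegral_enorm_fourierInv_rhoSymbol_le`).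

## References

* [Rauch1986] J. Rauch, Comm. Math. Phys. 106 (1986) 481–484, Proof of Theorem p. 483, (6).
* [Grafakos2014] L. Grafakos, *Classical Fourier Analysis*, 3rd ed. (2014), Prop. 5.1.14,
  Prop. 5.1.16 (`-I = Σ Rⱼ²`).
-/

noncomputable section

open MeasureTheory FourierTransform Filter Topology Module
open scoped SchwartzMap ENNReal NNReal ContDiff RealInnerProductSpace

namespace Literature.Analysis.Fourier

variable {d : ℕ} {ι : Type*} [Fintype ι]

/-! ### The annular cut-off `ρ_n` -/

variable (d) in
/-- The annular Fourier cut-off `ρ_n(ξ) = β(ξ/(n+1)) - β((n+1)ξ)`. [folklore] -/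
def annulusCutoff (n : ℕ) (ξ : EuclideanSpace ℝ (Fin d)) : ℝ :=
  spaceCutoff d n ξ - spaceBump d (((n : ℝ) + 1) • ξ)

/-- `ρ_n` is smooth. [folklore] -/
theorem annulusCutoff_contDiff (n : ℕ) : ContDiff ℝ ∞ (annulusCutoff d n) :=
  (spaceCutoff_contDiff n).sub ((spaceBump d).contDiff.comp (contDiff_const_smul _))

/-- `ρ_n` has compact support. [folklore] -/
theorem annulusCutoff_hasCompactSupport (n : ℕ) : HasCompactSupport (annulusCutoff d n) := by
  have hc : ((n : ℝ) + 1) ≠ 0 := by positivity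
  exact (spaceCutoff_hasCompactSupport n).sub
    ((spaceBump d).hasCompactSupport.comp_homeomorph (Homeomorph.smulOfNeZero _ hc))

/-- `|ρ_n| ≤ 1`. [folklore] -/
theorem abs_annulusCutoff_le (n : ℕ) (ξ : EuclideanSpace ℝ (Fin d)) :
    |annulusCutoff d n ξ| ≤ 1 := by
  rw [annulusCutoff, abs_le]
  have h1 := spaceCutoff_nonneg n ξ
  have h2 := spaceCutoff_le_one n ξ
  have h3 : 0 ≤ spaceBump d (((n : ℝ) + 1) • ξ) := (spaceBump d).nonneg
  have h4 : spaceBump d (((n : ℝ) + 1) • ξ) ≤ 1 := (spaceBump d).le_one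
  constructor <;> linarith

/-- `ρ_n(ξ) = 0` for `|ξ| ≤ 1/(n+1)`. [folklore] -/
theorem annulusCutoff_eq_zero {n : ℕ} {ξ : EuclideanSpace ℝ (Fin d)} (hξ : ‖ξ‖ ≤ ((n : ℝ) + 1)⁻¹) :
    annulusCutoff d n ξ = 0 := by
  have hn : (0 : ℝ) < (n : ℝ) + 1 := by positivity
  have h1 : spaceCutoff d n ξ = 1 := by
    refine spaceCutoff_eq_one (hξ.trans ?_)
    rw [inv_le_iff_one_le_mul₀ hn]
    nlinarith
  have h2 : spaceBump d (((n : ℝ) + 1) • ξ) = 1 := by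
    refine (spaceBump d).one_of_mem_closedBall ?_
    rw [Metric.mem_closedBall, dist_zero_right, norm_smul, Real.norm_eq_abs, abs_of_pos hn]
    show ((n : ℝ) + 1) * ‖ξ‖ ≤ 1
    calc ((n : ℝ) + 1) * ‖ξ‖ ≤ ((n : ℝ) + 1) * ((n : ℝ) + 1)⁻¹ := by gcongr
      _ = 1 := mul_inv_cancel₀ hn.ne'
  rw [annulusCutoff, h1, h2, sub_self]

/-- `ρ_n` vanishes on a neighbourhood of the origin. [folklore] -/
theorem annulusCutoff_eventuallyEq_zero (n : ℕ) :
    (annulusCutoff d n) =ᶠ[𝓝 0] fun _ => 0 := by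
  have hmem : Metric.closedBall (0 : EuclideanSpace ℝ (Fin d)) (((n : ℝ) + 1)⁻¹) ∈ 𝓝 0 :=
    Metric.closedBall_mem_nhds 0 (by positivity)
  filter_upwards [hmem] with ξ hξ
  rw [Metric.mem_closedBall, dist_zero_right] at hξ
  exact annulusCutoff_eq_zero hξ

/-- `ρ_n(0) = 0`. [folklore] -/
theorem annulusCutoff_zero (n : ℕ) : annulusCutoff d n 0 = 0 :=
  annulusCutoff_eq_zero (by rw [norm_zero]; positivity)

/-- For `ξ ≠ 0`, eventually `ρ_n(ξ) = 1`. [folklore] -/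
theorem eventually_annulusCutoff_eq_one {ξ : EuclideanSpace ℝ (Fin d)} (hξ : ξ ≠ 0) :
    ∀ᶠ n : ℕ in atTop, annulusCutoff d n ξ = 1 := by
  have hξ' : 0 < ‖ξ‖ := norm_pos_iff.2 hξ
  obtain ⟨N, hN⟩ := exists_nat_ge (2 / ‖ξ‖)
  filter_upwards [eventually_spaceCutoff_eq_one (d := d) ξ, eventually_ge_atTop N] with n hn1 hn2
  have hfar : spaceBump d (((n : ℝ) + 1) • ξ) = 0 := by
    refine (spaceBump d).zero_of_le_dist ?_
    rw [dist_zero_right, norm_smul, Real.norm_eq_abs, abs_of_pos (by positivity)]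
    show (2 : ℝ) ≤ ((n : ℝ) + 1) * ‖ξ‖
    have : (2 : ℝ) / ‖ξ‖ ≤ (n : ℝ) + 1 := hN.trans (by exact_mod_cast Nat.le_succ_of_le hn2)
    rwa [div_le_iff₀ hξ'] at this
  rw [annulusCutoff, hn1, hfar, sub_zero]

/-! ### Cut-off symbols as Schwartz functions -/

/-- `ρ_n m` (complexified) is smooth when `m` is smooth away from the origin. [folklore] -/
theorem contDiff_annulusCutoff_mul {m : EuclideanSpace ℝ (Fin d) → ℝ}
    (hm : ∀ ξ, ξ ≠ 0 → ContDiffAt ℝ ∞ m ξ) (n : ℕ) :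
    ContDiff ℝ ∞ fun ξ => ((annulusCutoff d n ξ * m ξ : ℝ) : ℂ) := by
  refine Complex.ofRealCLM.contDiff.comp (contDiff_iff_contDiffAt.2 fun ξ => ?_)
  rcases eq_or_ne ξ 0 with rfl | hξ
  · refine (contDiffAt_const (c := (0 : ℝ))).congr_of_eventuallyEq ?_
    filter_upwards [annulusCutoff_eventuallyEq_zero (d := d) n] with ξ hξ
    exact mul_eq_zero_of_left hξ _
  · exact (annulusCutoff_contDiff n).contDiffAt.mul (hm ξ hξ)

/-- `ρ_n m` has compact support. [folklore] -/
theorem hasCompactSupport_annulusCutoff_mul (m : EuclideanSpace ℝ (Fin d) → ℝ) (n : ℕ) :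
    HasCompactSupport fun ξ => ((annulusCutoff d n ξ * m ξ : ℝ) : ℂ) :=
  ((annulusCutoff_hasCompactSupport n).mul_right (f' := m)).comp_left Complex.ofReal_zero

/-- The Schwartz symbol `ρ_n m` for `m` real and smooth away from the origin. [folklore] -/
def annulusSymbol (n : ℕ) (m : EuclideanSpace ℝ (Fin d) → ℝ)
    (hm : ∀ ξ, ξ ≠ 0 → ContDiffAt ℝ ∞ m ξ) : 𝓢(EuclideanSpace ℝ (Fin d), ℂ) :=
  (hasCompactSupport_annulusCutoff_mul m n).toSchwartzMap (contDiff_annulusCutoff_mul hm n)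

/-- Values of `annulusSymbol`. [folklore] -/
@[simp] theorem annulusSymbol_apply (n : ℕ) (m : EuclideanSpace ℝ (Fin d) → ℝ)
    (hm : ∀ ξ, ξ ≠ 0 → ContDiffAt ℝ ∞ m ξ) (ξ : EuclideanSpace ℝ (Fin d)) :
    annulusSymbol n m hm ξ = ((annulusCutoff d n ξ * m ξ : ℝ) : ℂ) := rfl

/-- The coordinate `ξⱼ` is smooth. [folklore] -/
theorem contDiff_coord (j : Fin d) : ContDiff ℝ ∞ fun ξ : EuclideanSpace ℝ (Fin d) => ξ j :=
  contDiff_piLp_apply (p := 2)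

/-- `ξ ↦ ξⱼ/(2π|ξ|²)` is smooth away from the origin. [folklore] -/
theorem contDiffAt_coord_div_norm_sq (j : Fin d) {ξ : EuclideanSpace ℝ (Fin d)} (hξ : ξ ≠ 0) :
    ContDiffAt ℝ ∞ (fun ξ : EuclideanSpace ℝ (Fin d) => ξ j / (2 * Real.pi * ‖ξ‖ ^ 2)) ξ :=
  (contDiff_coord j).contDiffAt.div (contDiff_const.mul (contDiff_norm_sq ℝ)).contDiffAt
    (by positivity)

/-- `ξ ↦ ξⱼ/|ξ|` is smooth away from the origin. [folklore] -/
theorem contDiffAt_coord_div_norm (j : Fin d) {ξ : EuclideanSpace ℝ (Fin d)} (hξ : ξ ≠ 0) :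
    ContDiffAt ℝ ∞ (fun ξ : EuclideanSpace ℝ (Fin d) => ξ j / ‖ξ‖) ξ :=
  (contDiff_coord j).contDiffAt.div (contDiffAt_norm ℝ hξ) (norm_ne_zero_iff.2 hξ)

variable (d) in
/-- The Schwartz symbol `ρ_n`. [folklore] -/
def rhoSymbol (n : ℕ) : 𝓢(EuclideanSpace ℝ (Fin d), ℂ) :=
  annulusSymbol n (fun _ => 1) fun _ _ => contDiffAt_const

/-- `rhoSymbol n ξ = ρ_n(ξ)`. [folklore] -/
@[simp] theorem rhoSymbol_apply (n : ℕ) (ξ : EuclideanSpace ℝ (Fin d)) :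
    rhoSymbol d n ξ = ((annulusCutoff d n ξ : ℝ) : ℂ) := by
  rw [rhoSymbol, annulusSymbol_apply, mul_one]

/-- The Schwartz symbol `a_{n,j}(ξ) = ρ_n(ξ) ξⱼ/(2πi|ξ|²) = -i ρ_n(ξ) ξⱼ/(2π|ξ|²)`.
[cite: Rauch1986, Proof of Theorem p. 483, (6)] -/
def aSymbol (n : ℕ) (j : Fin d) : 𝓢(EuclideanSpace ℝ (Fin d), ℂ) :=
  (-Complex.I) • annulusSymbol n (fun ξ => ξ j / (2 * Real.pi * ‖ξ‖ ^ 2))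
    fun _ hξ => contDiffAt_coord_div_norm_sq j hξ

/-- Values of `aSymbol`. [folklore] -/
theorem aSymbol_apply (n : ℕ) (j : Fin d) (ξ : EuclideanSpace ℝ (Fin d)) :
    aSymbol n j ξ =
      -Complex.I * ((annulusCutoff d n ξ * (ξ j / (2 * Real.pi * ‖ξ‖ ^ 2)) : ℝ) : ℂ) := by
  rw [aSymbol, smul_apply, annulusSymbol_apply, smul_eq_mul]

/-- The Schwartz symbol `b_{n,j}(ξ) = ρ_n(ξ) rⱼ(ξ) = -i ρ_n(ξ) ξⱼ/|ξ|` (cut-off Riesz symbol).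
[cite: Grafakos2014, Prop. 5.1.14] -/
def bSymbol (n : ℕ) (j : Fin d) : 𝓢(EuclideanSpace ℝ (Fin d), ℂ) :=
  (-Complex.I) • annulusSymbol n (fun ξ => ξ j / ‖ξ‖) fun _ hξ => contDiffAt_coord_div_norm j hξ

/-- Values of `bSymbol`: `b_{n,j} = ρ_n rⱼ`. [folklore] -/
theorem bSymbol_apply (n : ℕ) (j : Fin d) (ξ : EuclideanSpace ℝ (Fin d)) :
    bSymbol n j ξ = ((annulusCutoff d n ξ : ℝ) : ℂ) * rieszSymbol j ξ := by
  rw [bSymbol, smul_apply, annulusSymbol_apply, smul_eq_mul, rieszSymbol]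
  push_cast
  ring

/-! ### The two symbol identities -/

/-- **`Σⱼ 2πiξⱼ a_{n,j}(ξ) = ρ_n(ξ)`** (`Σⱼ ξⱼ² = |ξ|²`; both sides vanish at `ξ = 0`): the symbol
identity behind `Σⱼ ∂ⱼφ_{n,j} = ψ_n`. [cite: Grafakos2014, Prop. 5.1.16] -/
theorem sum_deriv_mul_aSymbol (n : ℕ) (ξ : EuclideanSpace ℝ (Fin d)) :
    ∑ j, (2 * Real.pi * Complex.I * ((ξ j : ℝ) : ℂ)) * aSymbol n j ξ = rhoSymbol d n ξ := by
  rcases eq_or_ne ξ 0 with rfl | hξ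
  · simp [aSymbol_apply, annulusCutoff_zero]
  have hn : (‖ξ‖ : ℝ) ≠ 0 := norm_ne_zero_iff.2 hξ
  have hnc : ((‖ξ‖ : ℝ) : ℂ) ≠ 0 := by exact_mod_cast hn
  have hpi : ((Real.pi : ℝ) : ℂ) ≠ 0 := by exact_mod_cast Real.pi_ne_zero
  have hsum : ∑ j, ((ξ j : ℝ) : ℂ) ^ 2 = ((‖ξ‖ : ℝ) : ℂ) ^ 2 := by
    have := EuclideanSpace.real_norm_sq_eq ξ
    have h2 : ((‖ξ‖ ^ 2 : ℝ) : ℂ) = ((∑ i, (ξ i) ^ 2 : ℝ) : ℂ) := by rw [this]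
    push_cast at h2
    exact h2.symm
  have hterm : ∀ j, (2 * Real.pi * Complex.I * ((ξ j : ℝ) : ℂ)) * aSymbol n j ξ =
      ((annulusCutoff d n ξ : ℝ) : ℂ) * ((ξ j : ℝ) : ℂ) ^ 2 / ((‖ξ‖ : ℝ) : ℂ) ^ 2 := by
    intro j
    rw [aSymbol_apply]
    push_cast
    field_simp
    rw [Complex.I_sq]
    ring
  simp_rw [hterm, rhoSymbol_apply]
  rw [← Finset.sum_div, ← Finset.mul_sum, hsum, mul_div_assoc, div_self (pow_ne_zero 2 hnc),
    mul_one]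

/-- **`2πiξ_l a_{n,j}(ξ) = -r_l(ξ) b_{n,j}(ξ)`** (both equal `ρ_n(ξ)ξ_lξⱼ/|ξ|²`): the symbol
identity behind `∂_lφ_{n,j} = -R_l θ_{n,j}`. [cite: Grafakos2014, Prop. 5.1.14] -/
theorem deriv_mul_aSymbol_eq (n : ℕ) (j l : Fin d) (ξ : EuclideanSpace ℝ (Fin d)) :
    (2 * Real.pi * Complex.I * ((ξ l : ℝ) : ℂ)) * aSymbol n j ξ =
      -(rieszSymbol l ξ * bSymbol n j ξ) := by
  rcases eq_or_ne ξ 0 with rfl | hξ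
  · simp [aSymbol_apply, bSymbol_apply, annulusCutoff_zero]
  have hn : (‖ξ‖ : ℝ) ≠ 0 := norm_ne_zero_iff.2 hξ
  have hnc : ((‖ξ‖ : ℝ) : ℂ) ≠ 0 := by exact_mod_cast hn
  have hpi : ((Real.pi : ℝ) : ℂ) ≠ 0 := by exact_mod_cast Real.pi_ne_zero
  rw [aSymbol_apply, bSymbol_apply, rieszSymbol, rieszSymbol]
  push_cast
  field_simp

/-! ### Schwartz Fourier-multiplier images -/

variable {V : Type*} [NormedAddCommGroup V] [InnerProductSpace ℝ V] [FiniteDimensional ℝ V]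
  [MeasurableSpace V] [BorelSpace V]

/-- `𝓕⁻¹(g 𝓕ψ)` as a function: the coercion of the Schwartz Fourier-multiplier image.
[folklore] -/
theorem coe_fourierMultiplierCLM_schwartz (g : 𝓢(V, ℂ)) (ψ : 𝓢(V, ι → ℂ)) :
    ⇑(SchwartzMap.fourierMultiplierCLM (ι → ℂ) (⇑g) ψ) = 𝓕⁻ (fun ξ => g ξ • 𝓕 (⇑ψ) ξ) := by
  rw [SchwartzMap.fourierMultiplierCLM_apply, SchwartzMap.fourierInv_coe]
  congr 1
  funext ξ
  rw [SchwartzMap.smulLeftCLM_apply_apply g.hasTemperateGrowth, SchwartzMap.fourier_coe]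

/-- `𝓕(𝓕⁻¹(g 𝓕ψ)) = g 𝓕ψ`. [folklore] -/
theorem fourier_coe_fourierMultiplierCLM_schwartz (g : 𝓢(V, ℂ)) (ψ : 𝓢(V, ι → ℂ)) :
    𝓕 (⇑(SchwartzMap.fourierMultiplierCLM (ι → ℂ) (⇑g) ψ)) = fun ξ => g ξ • 𝓕 (⇑ψ) ξ := by
  rw [← SchwartzMap.fourier_coe, SchwartzMap.fourierMultiplierCLM_apply, fourier_fourierInv_eq]
  funext ξ
  rw [SchwartzMap.smulLeftCLM_apply_apply g.hasTemperateGrowth, SchwartzMap.fourier_coe]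

/-- The image is the Bochner multiplier operator with symbol `g • 1`. [folklore] -/
theorem coe_fourierMultiplierCLM_schwartz_eq_multiplierOp [DecidableEq ι] (g : 𝓢(V, ℂ))
    (ψ : 𝓢(V, ι → ℂ)) :
    ⇑(SchwartzMap.fourierMultiplierCLM (ι → ℂ) (⇑g) ψ) =
      multiplierOp (fun ξ => g ξ • (1 : Matrix ι ι ℂ)) ⇑ψ :=
  (multiplierOp_smul_one g.hasTemperateGrowth ψ).symm

omit [MeasurableSpace V] [BorelSpace V] in
/-- `𝓕(∂ᵥh)(ξ) = 2πi⟨ξ, v⟩ 𝓕h(ξ)` for Schwartz `h` (Mathlib, restated on plain functions).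
[folklore] -/
theorem fourier_fderiv_apply_schwartz [MeasurableSpace V] [BorelSpace V] (h : 𝓢(V, ι → ℂ))
    (v ξ : V) :
    𝓕 (fun y => fderiv ℝ (⇑h) y v) ξ = (2 * Real.pi * Complex.I * (⟪ξ, v⟫ : ℝ)) • 𝓕 (⇑h) ξ := by
  open LineDeriv in
  have h1 : (fun y => fderiv ℝ (⇑h) y v) = ⇑(∂_{v} h : 𝓢(V, ι → ℂ)) := rfl
  have htg : (fun y : V => ⟪y, v⟫).HasTemperateGrowth := ((innerSL ℝ).flip v).hasTemperateGrowth
  rw [h1, ← SchwartzMap.fourier_coe, SchwartzMap.fourier_lineDerivOp_eq, smul_apply,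
    SchwartzMap.smulLeftCLM_apply_apply htg, SchwartzMap.fourier_coe, ← Complex.coe_smul, smul_smul]

/-- `𝓕(∂ⱼh)(ξ) = 2πiξⱼ 𝓕h(ξ)` on `ℝᵈ`. [folklore] -/
theorem fourier_partialDeriv_schwartz (h : 𝓢(EuclideanSpace ℝ (Fin d), ι → ℂ)) (j : Fin d)
    (ξ : EuclideanSpace ℝ (Fin d)) :
    𝓕 (partialDeriv j ⇑h) ξ = (2 * Real.pi * Complex.I * ((ξ j : ℝ) : ℂ)) • 𝓕 (⇑h) ξ := by
  have : partialDeriv j ⇑h = fun y => fderiv ℝ (⇑h) y (EuclideanSpace.single j (1 : ℝ)) := rfl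
  rw [this, fourier_fderiv_apply_schwartz, EuclideanSpace.inner_single_right]
  simp

/-! ### `‖𝓕⁻¹ρ_n‖_{L¹} ≤ 2‖𝓕⁻¹β‖_{L¹}` -/

/-- The complexified bump as a Schwartz function. [folklore] -/
def bumpSchwartz (d : ℕ) : 𝓢(EuclideanSpace ℝ (Fin d), ℂ) :=
  (((spaceBump d).hasCompactSupport).comp_left Complex.ofReal_zero).toSchwartzMap
    (Complex.ofRealCLM.contDiff.comp (spaceBump d).contDiff)

/-- `bumpSchwartz d ξ = β(ξ)`. [folklore] -/
@[simp] theorem bumpSchwartz_apply (ξ : EuclideanSpace ℝ (Fin d)) :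
    bumpSchwartz d ξ = ((spaceBump d ξ : ℝ) : ℂ) := rfl

/-- `L¹` norm of the inverse Fourier transform is dilation invariant: for `c > 0`,
`‖𝓕⁻¹(f(c·))‖_{L¹} = ‖𝓕⁻¹f‖_{L¹}`. [cite: Grafakos2014, Prop. 2.5.14] -/
theorem lintegral_enorm_fourierInv_comp_smul (f : EuclideanSpace ℝ (Fin d) → ℂ) {c : ℝ}
    (hc : 0 < c) :
    ∫⁻ ξ, ‖𝓕⁻ (fun x => f (c • x)) ξ‖ₑ = ∫⁻ ξ, ‖𝓕⁻ f ξ‖ₑ := by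
  rw [fourierInv_comp_smul f hc.ne']
  simp only [enorm_smul]
  rw [lintegral_const_mul' _ _ (by simp)]
  have hscale := lintegral_eq_mul_lintegral_comp_smul (E := EuclideanSpace ℝ (Fin d))
    (fun ξ => ‖𝓕⁻ f (c⁻¹ • ξ)‖ₑ) hc
  rw [hscale]
  have hcc : ∀ u : EuclideanSpace ℝ (Fin d), c⁻¹ • c • u = u := fun u => by
    rw [smul_smul, inv_mul_cancel₀ hc.ne', one_smul]
  simp_rw [hcc]
  rw [← mul_assoc]
  have : ‖|(c ^ finrank ℝ (EuclideanSpace ℝ (Fin d)))⁻¹|‖ₑ *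
      ENNReal.ofReal (c ^ finrank ℝ (EuclideanSpace ℝ (Fin d))) = 1 := by
    rw [Real.enorm_eq_ofReal_abs, abs_abs, abs_of_pos (by positivity),
      ← ENNReal.ofReal_mul (by positivity), inv_mul_cancel₀ (by positivity), ENNReal.ofReal_one]
  rw [this, one_mul]

/-- `𝓕⁻ (F - G) = 𝓕⁻ F - 𝓕⁻ G` for integrable `F, G`. [folklore] -/
theorem fourierInv_sub' {E : Type*} [NormedAddCommGroup E] [NormedSpace ℂ E] [CompleteSpace E]
    {F G : V → E} (hF : Integrable F) (hG : Integrable G) : 𝓕⁻ (F - G) = 𝓕⁻ F - 𝓕⁻ G := by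
  rw [sub_eq_add_neg, fourierInv_add' hF hG.neg, ← neg_one_smul ℂ G, fourierInv_const_smul',
    neg_one_smul, ← sub_eq_add_neg]

/-- `ρ_n = β(·/(n+1)) - β((n+1)·)` as complex functions. [folklore] -/
theorem coe_rhoSymbol_eq (n : ℕ) :
    (⇑(rhoSymbol d n) : EuclideanSpace ℝ (Fin d) → ℂ) =
      (fun ξ => bumpSchwartz d ((((n : ℝ) + 1)⁻¹) • ξ)) -
        fun ξ => bumpSchwartz d (((n : ℝ) + 1) • ξ) := by
  funext ξ
  rw [rhoSymbol_apply, Pi.sub_apply, bumpSchwartz_apply, bumpSchwartz_apply, annulusCutoff,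
    spaceCutoff, Complex.ofReal_sub]

/-- **`‖𝓕⁻¹ρ_n‖_{L¹} ≤ 2‖𝓕⁻¹β‖_{L¹}`**, uniformly in `n` (dilation invariance).
[cite: Grafakos2014, Prop. 2.5.14] -/
theorem lintegral_enorm_fourierInv_rhoSymbol_le (n : ℕ) :
    ∫⁻ x, ‖𝓕⁻ (⇑(rhoSymbol d n)) x‖ₑ ≤ 2 * ∫⁻ x, ‖𝓕⁻ (⇑(bumpSchwartz d)) x‖ₑ := by
  have hn : (0 : ℝ) < (n : ℝ) + 1 := by positivity
  have hint : ∀ {c : ℝ}, c ≠ 0 →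
      Integrable fun ξ : EuclideanSpace ℝ (Fin d) => bumpSchwartz d (c • ξ) := fun {c} hc =>
    (bumpSchwartz d).integrable.comp_smul hc
  rw [coe_rhoSymbol_eq, fourierInv_sub' (hint (inv_ne_zero hn.ne')) (hint hn.ne')]
  calc ∫⁻ x, ‖(𝓕⁻ (fun ξ => bumpSchwartz d ((((n : ℝ) + 1)⁻¹) • ξ)) -
          𝓕⁻ (fun ξ => bumpSchwartz d (((n : ℝ) + 1) • ξ))) x‖ₑ
      ≤ ∫⁻ x, ‖𝓕⁻ (fun ξ => bumpSchwartz d ((((n : ℝ) + 1)⁻¹) • ξ)) x‖ₑ +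
          ‖𝓕⁻ (fun ξ => bumpSchwartz d (((n : ℝ) + 1) • ξ)) x‖ₑ :=
        lintegral_mono fun x => enorm_sub_le
    _ = (∫⁻ x, ‖𝓕⁻ (fun ξ => bumpSchwartz d ((((n : ℝ) + 1)⁻¹) • ξ)) x‖ₑ) +
          ∫⁻ x, ‖𝓕⁻ (fun ξ => bumpSchwartz d (((n : ℝ) + 1) • ξ)) x‖ₑ :=
        lintegral_add_left' (continuous_fourierInv_of_integrable
          (hint (inv_ne_zero hn.ne'))).aestronglyMeasurable.enorm _
    _ = 2 * ∫⁻ x, ‖𝓕⁻ (⇑(bumpSchwartz d)) x‖ₑ := by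
        rw [lintegral_enorm_fourierInv_comp_smul _ (inv_pos.2 hn),
          lintegral_enorm_fourierInv_comp_smul _ hn, two_mul]

/-- `‖𝓕⁻¹β‖_{L¹} < ∞`. [folklore] -/
theorem lintegral_enorm_fourierInv_bumpSchwartz_lt_top (d : ℕ) :
    ∫⁻ x, ‖𝓕⁻ (⇑(bumpSchwartz d)) x‖ₑ < ⊤ := by
  rw [← SchwartzMap.fourierInv_coe]
  exact (𝓕⁻ (bumpSchwartz d)).integrable.hasFiniteIntegral

end Literature.Analysis.Fourier

end
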